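import Summits.QuantumAdvantage.AdviceFreeQNC0.FibreDecimation37
import Summits.QuantumAdvantage.AdviceFreeQNC0.FibreDecimation37Laws
import Summits.QuantumAdvantage.AdviceFreeQNC0.BlockCombJoin37
import Summits.QuantumAdvantage.AdviceFreeQNC0.CubeUncertainty38
import HarnessLib

/-!
# Cell qa-qnc0 — p2 gen 38: SUB-ROW DECIMATION, typed over the tree's `Exp37` vocabulary (memo `qa-qnc0-p2/ROUND-38P2.md`)

Custody file (D-0168 E1 shelf: no ledger items; evidence on `stmt-QuantumAdvantage-22907`).  Everything is stated over the TREE port of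
p2 gen 37's fibre vocabulary (`Summits.QuantumAdvantage.AdviceFreeQNC0.FibreDecimation37{,Laws}`, namespace `…Exp37`: `Compatible`, `JCond`,
`decimSet`, `weightY`, `coset`, `testParity`, `affTarget`, `lettZ_ne_zero`, `neg_lettZ_ne`), so that a prover can port it verbatim.

Contents (namespace `Summit.QuantumAdvantage.AdviceFreeQNC0.Exp38p2`):
* **v2 (§3.3)**: `not_jCond_zero` (blind rows drop out), `jCond_of_supp_le_three` / `four_le_supp_of_not_jCond` (a row meeting `M`
  in ≤ 3 coins always survives) — the engines of the iterated rounds (Lemma 38.Q, Theorem 38.N) — PROVED.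
* **Lemma 38.A′ — PROVED (all `m`)**: `jCondIffCounts : JCond a δ ↔ δ ≠ 0 ∧ (defects a δ ≤ 1 ∨ agreements a δ ≤ 1)` — the J-condition in
  closed form (zeros are free; a row survives the `L_a`-decimation iff it has at most one sign defect against `a`, or at most one agreement).
  Corollaries: `not_jCond_of_two_two` (two defects and two agreements kill a row — the anti-seed exclusion of memo §3.1, containing p2's
  `mixedExcludes`), `jCond_of_single` (a row meeting `M` in exactly one coin always survives — the LOAD WALL of memo §3.1).
* **(NH_{s₀})** `NHs` and **Theorem 38.F** `FibreNonExact38` (target): 37.F′ with a SUB-ROW base row (`Compatible`, `≥ 2` non-zero entries;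
  Lemma 38.A) and the MIXED-NORM third step (short relations free; Lemma 38.C).
* **Corollary 38.E at `p = 1/2`** in the (J3) format of `BlockFibre37.PerOutputFormsHardConst` (`r = 1`, 0/1 forms): `SubsetFormsHardHalf`
  (target) and the bookkeeping `subsetFormsHardHalf_of_perOutput` (proved).
* **Conjecture 38.L** `InverseNearExact` — the inverse theorem for near-exact MOD-3 test systems (= p1's (L1) in adversarial form).
-/

noncomputable section

open Classical

namespace Summit.QuantumAdvantage.AdviceFreeQNC0.Exp38p2

open Finset
open Summit.QuantumAdvantage.AdviceFreeQNC0 F4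
open Summit.QuantumAdvantage.AdviceFreeQNC0.Exp37

variable {m : ℕ}

/-! (Tree port, qn-prover-3 g24: PART 1 of the custody file `qa-qnc0-p2/exp38p2/SubRowDecimation38.lean` v8, sha 10c66426b3b281ba —
Lemma 38.A′ and the iterated-rounds engines, verbatim; PART 2 = `SubRowDecimation38B.lean`.) -/

/-! ### Lemma 38.A′ — the J-condition in closed form (memo §1.1 (i), §3.1) -/

/-- Number of SIGN DEFECTS of `δ` against the pattern `a` (coordinates carrying the letter `−a_i`). -/
def defects (a : Fin m → Bool) (δ : Fin m → ZMod 3) : ℕ :=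
  (univ.filter fun i => δ i = -lettZ (a i)).card

/-- Number of coordinates where `δ` carries exactly the letter `a_i`. -/
def agreements (a : Fin m → Bool) (δ : Fin m → ZMod 3) : ℕ :=
  (univ.filter fun i => δ i = lettZ (a i)).card

/-- Every element of `𝔽₃` is `0`, the letter, or the anti-letter. -/
theorem letter_trichotomy (b : Bool) (x : ZMod 3) : x = 0 ∨ x = lettZ b ∨ x = -lettZ b := by
  cases b <;> revert x <;> decide

/-- `−ℓ + 1 ≠ −ℓ` and `ℓ ≠ 0`-type bookkeeping in `𝔽₃`. -/
theorem add_one_ne_self (x : ZMod 3) : x + 1 ≠ x := by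
  revert x; decide

/-- Compatibility = no sign defect. -/
theorem compatible_iff_no_defect (a : Fin m → Bool) (δ : Fin m → ZMod 3) :
    Compatible a δ ↔ ∀ i, δ i ≠ -lettZ (a i) := by
  constructor
  · intro h i hi
    have hne : δ i ≠ 0 := by rw [hi]; exact neg_ne_zero.mpr (lettZ_ne_zero _)
    have := h i hne
    rw [hi] at this
    exact neg_lettZ_ne _ this
  · intro h i hne
    rcases letter_trichotomy (a i) (δ i) with h0 | hl | hn
    · exact absurd h0 hne
    · exact hl
    · exact absurd hn (h i)

/-- Compatibility of `−δ` = no agreement of `δ`. -/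
theorem compatible_neg_iff_no_agreement (a : Fin m → Bool) (δ : Fin m → ZMod 3) :
    Compatible a (-δ) ↔ ∀ i, δ i ≠ lettZ (a i) := by
  rw [compatible_iff_no_defect]
  refine forall_congr' fun i => ?_
  simp only [Pi.neg_apply, ne_eq, neg_inj]

/-- Compatibility after the one-coin correction `+ e_i`. -/
theorem compatible_add_single_iff (a : Fin m → Bool) (δ : Fin m → ZMod 3) (i : Fin m) :
    Compatible a (δ + Pi.single i 1) ↔ (∀ j, j ≠ i → δ j ≠ -lettZ (a j)) ∧ δ i + 1 ≠ -lettZ (a i) := by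
  rw [compatible_iff_no_defect]
  constructor
  · intro h
    refine ⟨fun j hj => ?_, ?_⟩
    · have := h j
      simpa [Pi.add_apply, Pi.single_apply, hj] using this
    · have := h i
      simpa [Pi.add_apply, Pi.single_apply] using this
  · rintro ⟨h1, h2⟩ j
    by_cases hj : j = i
    · subst hj; simpa [Pi.add_apply, Pi.single_apply] using h2
    · simpa [Pi.add_apply, Pi.single_apply, hj] using h1 j hj

/-- A finset all of whose members equal a given element has at most one element. -/
theorem card_le_one_of_forall_eq {α : Type*} (t : Finset α) (i : α) (h : ∀ j ∈ t, j = i) : t.card ≤ 1 :=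
  Finset.card_le_one.mpr fun x hx y hy => by rw [h x hx, h y hy]

/-- **Lemma 38.A′ (closed form of the J-condition) — PROVED for every `m`.**  A direction survives the `L_a`-decimation iff it is
non-zero and EITHER has at most one sign defect against `a` (then `δ` or `δ + e_i` is compatible) OR at most one agreement with `a`
(then `−δ` or `−δ + e_i` is).  Zeros never matter. -/
theorem jCondIffCounts (a : Fin m → Bool) (δ : Fin m → ZMod 3) :
    JCond a δ ↔ (δ ≠ 0 ∧ (defects a δ ≤ 1 ∨ agreements a δ ≤ 1)) := by
  unfold JCond defects agreements
  refine and_congr_right fun hδ => ?_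
  constructor
  · rintro (hc | hc | ⟨i, hc | hc⟩)
    · left
      rw [compatible_iff_no_defect] at hc
      have : (univ.filter fun i => δ i = -lettZ (a i)) = ∅ :=
        filter_eq_empty_iff.mpr fun i _ => hc i
      rw [this]; simp
    · right
      rw [compatible_neg_iff_no_agreement] at hc
      have : (univ.filter fun i => δ i = lettZ (a i)) = ∅ :=
        filter_eq_empty_iff.mpr fun i _ => hc i
      rw [this]; simp
    · left
      rw [compatible_add_single_iff] at hc
      exact card_le_one_of_forall_eq _ i fun j hj => by
        by_contra hne
        exact hc.1 j hne (mem_filter.mp hj).2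
    · right
      have hc' : Compatible a ((-δ) + Pi.single i 1) := hc
      rw [compatible_add_single_iff] at hc'
      exact card_le_one_of_forall_eq _ i fun j hj => by
        by_contra hne
        exact hc'.1 j hne (by simp only [Pi.neg_apply, (mem_filter.mp hj).2])
  · rintro (hD | hA)
    · -- at most one defect
      by_cases h0 : (univ.filter fun i => δ i = -lettZ (a i)) = ∅
      · left
        rw [compatible_iff_no_defect]
        intro i hi
        have : i ∈ (univ.filter fun i => δ i = -lettZ (a i)) := by simp [hi]
        rw [h0] at this; simp at this
      · obtain ⟨i, hi⟩ := nonempty_iff_ne_empty.mpr h0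
        right; right
        refine ⟨i, Or.inl ?_⟩
        rw [compatible_add_single_iff]
        rw [mem_filter] at hi
        refine ⟨fun j hj hj' => hj ?_, ?_⟩
        · have hj'' : j ∈ (univ.filter fun i => δ i = -lettZ (a i)) := by simp [hj']
          exact Finset.card_le_one.mp hD j hj'' i (by simp [hi.2])
        · rw [hi.2]; exact add_one_ne_self _
    · -- at most one agreement
      by_cases h0 : (univ.filter fun i => δ i = lettZ (a i)) = ∅
      · right; left
        rw [compatible_neg_iff_no_agreement]
        intro i hi
        have : i ∈ (univ.filter fun i => δ i = lettZ (a i)) := by simp [hi]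
        rw [h0] at this; simp at this
      · obtain ⟨i, hi⟩ := nonempty_iff_ne_empty.mpr h0
        right; right
        refine ⟨i, Or.inr ?_⟩
        show Compatible a ((-δ) + Pi.single i 1)
        rw [compatible_add_single_iff]
        rw [mem_filter] at hi
        refine ⟨fun j hj hj' => hj ?_, ?_⟩
        · have hj'' : j ∈ (univ.filter fun i => δ i = lettZ (a i)) := by
            simp only [Pi.neg_apply, neg_inj] at hj'
            simp [hj']
          exact Finset.card_le_one.mp hA j hj'' i (by simp [hi.2])
        · simp only [Pi.neg_apply, hi.2]
          exact add_one_ne_self _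

/-- **Anti-seed exclusion (memo §3.1, Lemma 38.G's core; contains p2's `mixedExcludes`).**  Two defects and two agreements kill a row,
whatever its other entries (in particular whatever its zeros). -/
theorem not_jCond_of_two_two (a : Fin m → Bool) (δ : Fin m → ZMod 3)
    (hD : 2 ≤ defects a δ) (hA : 2 ≤ agreements a δ) : ¬ JCond a δ := by
  rw [jCondIffCounts]
  rintro ⟨_, h | h⟩ <;> omega

/-- **The load wall (memo §3.1).**  A row meeting the decimation coins in exactly ONE coin (any non-zero letter there) always survives. -/
theorem jCond_of_single (a : Fin m → Bool) (i : Fin m) (x : ZMod 3) (hx : x ≠ 0) :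
    JCond a (Pi.single i x) := by
  rw [jCondIffCounts]
  refine ⟨fun h => hx (by simpa using congrFun h i), ?_⟩
  -- the defect set and the agreement set are both inside `{i}`
  rcases letter_trichotomy (a i) x with h0 | hl | hn
  · exact absurd h0 hx
  · -- `x` is the letter: no defects at all
    left
    unfold defects
    refine card_le_one_of_forall_eq _ i fun j hj => ?_
    by_contra hne
    have h2 := (mem_filter.mp hj).2
    rw [Pi.single_apply, if_neg hne] at h2
    exact (neg_ne_zero.mpr (lettZ_ne_zero (a j))) h2.symm
  · -- `x` is the anti-letter: no agreements at all
    right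
    unfold agreements
    refine card_le_one_of_forall_eq _ i fun j hj => ?_
    by_contra hne
    have h2 := (mem_filter.mp hj).2
    rw [Pi.single_apply, if_neg hne] at h2
    exact (lettZ_ne_zero (a j)) h2.symm

/- kernel cross-check of `jCondIffCounts` at `m = 3` by brute force (all `8 · 27` pairs). -/
set_option maxRecDepth 20000 in
example : ∀ (a : Fin 3 → Bool) (δ : Fin 3 → ZMod 3),
    JCond a δ ↔ (δ ≠ 0 ∧ (defects a δ ≤ 1 ∨ agreements a δ ≤ 1)) := by
  unfold JCond Compatible defects agreements lettZ
  decide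

/-! ### Iterated rounds (memo §3.3, v2): blind rows drop out, sparse touchers always survive

In a decimation round only rows meeting the decimation coins `M` survive (`JCond` needs `δ ≠ 0`), and a row meeting `M` in at most
three coins survives whatever its letters (death needs two defects AND two agreements).  These two facts drive the "small rounds"
(blindness filter, Lemma 38.Q) and bound the per-round survival function (Lemma 38.N/38.O) of the memo. -/

/-- Blind rows (`δ = 0`) never survive a round. -/
theorem not_jCond_zero (a : Fin m → Bool) : ¬ JCond a 0 := by
  rw [jCondIffCounts]
  exact fun h => h.1 rfl

/-- The support of a restricted row. -/
def suppM (δ : Fin m → ZMod 3) : Finset (Fin m) := univ.filter fun i => δ i ≠ 0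

/-- Defects and agreements are disjoint parts of the support. -/
theorem defects_add_agreements_le (a : Fin m → Bool) (δ : Fin m → ZMod 3) :
    defects a δ + agreements a δ ≤ (suppM δ).card := by
  unfold defects agreements suppM
  rw [← card_union_of_disjoint]
  · apply card_le_card
    intro i hi
    rcases mem_union.mp hi with h | h
    · have h := (mem_filter.mp h).2
      exact mem_filter.mpr ⟨mem_univ _, by rw [h]; exact neg_ne_zero.mpr (lettZ_ne_zero (a i))⟩
    · have h := (mem_filter.mp h).2
      exact mem_filter.mpr ⟨mem_univ _, by rw [h]; exact lettZ_ne_zero (a i)⟩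
  · rw [disjoint_filter]
    intro i _ h1 h2
    exact neg_lettZ_ne (a i) (h1.symm.trans h2)

/-- **Sparse touchers survive (Lemma 38.Q's engine).**  A non-blind row with at most three non-zero entries on `M` is always in `J`. -/
theorem jCond_of_supp_le_three (a : Fin m → Bool) (δ : Fin m → ZMod 3) (h0 : δ ≠ 0) (h3 : (suppM δ).card ≤ 3) :
    JCond a δ := by
  rw [jCondIffCounts]
  refine ⟨h0, ?_⟩
  have := defects_add_agreements_le a δ
  omega

/-- Conversely a dead row has at least four non-zero entries on `M`. -/
theorem four_le_supp_of_not_jCond (a : Fin m → Bool) (δ : Fin m → ZMod 3) (h0 : δ ≠ 0) (h : ¬ JCond a δ) :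
    4 ≤ (suppM δ).card := by
  by_contra h4
  exact h (jCond_of_supp_le_three a δ h0 (by omega))

end Summit.QuantumAdvantage.AdviceFreeQNC0.Exp38p2
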